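import Summits.Ventures.PercRepro.Night2FatXGenericEleven
import Summits.Ventures.PercRepro.Night2FatXLinesGeneric

/-!
# night-2: a point lies on at most one basis line; the loaded targets through a point of a basis line

Two distinct basis lines (lines through two of the four independent basis points off `w₀`) meet in no point of
`W ∖ {x}` (`not_on_two_basis_lines`: their closures meet in a flat of rank `≤ 4 − |{a, b} ∪ {a′, b′}|`).  Hence, with
generic off-points, a loaded target through `x` and a point `y₁` of the basis line `ℓ₁` has its `Y = T ∖ Q ∖ {x}`
inside `ℓ₁` (`exists_basis_line_of_dist_one_fat`), so the loaded targets through `x, y₁` at level `j` number at most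
`C(t₁ − 1, j − 2)`, `t₁` the number of points of `W ∖ {x}` on `ℓ₁` (`card_loaded_targets_through_le`), and the
unloaded ones at least `C(m − 1, j − 2) − C(t₁ − 1, j − 2)` (`fat_count_level_ge_line_point`).
Paper `proofs/NIGHT-2-g33.md` §6 (d).
-/

namespace PercRepro.Shadow

open PercRepro.ThmH PercRepro.PerFlat

variable {α : Type*} [DecidableEq α] {M : Matroid α} [M.Finite] {G : Finset α}

/-- **A point of `W ∖ {x}` lies on at most one basis line.** -/
theorem not_on_two_basis_lines (hG : G ∈ flatsQ M (5 + 1)) (hd : (gr M \ G).card = 2) (hk : kColoops M G = 1)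
    (hs : ∀ e ∈ gr M, ∀ f ∈ gr M, e ≠ f → rkN M {e, f} = 2) (hl : ∀ e ∈ gr M, M.Indep {e})
    {B : Finset α} (hB : B ∈ thinMembers M 5 G) (hnP : ¬ bigP M G B) {z : α} (hz : z ∈ G \ clF M B)
    {a b a' b' : α} (ha : a ∈ insert z B \ coloops M G) (hb : b ∈ insert z B \ coloops M G)
    (ha' : a' ∈ insert z B \ coloops M G) (hb' : b' ∈ insert z B \ coloops M G) (hab : a ≠ b) (hab' : a' ≠ b')
    (hne : ({a, b} : Finset α) ≠ {a', b'}) {y : α} (hy : y ∈ G \ insert z B)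
    (h1 : rkN M {a, b, y} ≤ 2) (h2 : rkN M {a', b', y} ≤ 2) : False := by
  have hGg : G ⊆ gr M := (mem_flatsQ.1 hG).1
  have hQG : insert z B ⊆ G :=
    Finset.insert_subset (Finset.mem_sdiff.1 hz).1 (subset_G_of_mem_thinMembers hB)
  have hyG : y ∈ G := (Finset.mem_sdiff.1 hy).1
  have hyQ : y ∉ insert z B := (Finset.mem_sdiff.1 hy).2
  have hQ5 := card_insert_sdiff_eq_five hG hd hk hB hnP hz
  have hrk5 := rkN_insert_sdiff_coloops_eq_five_of_thin hG hd hk hB hz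
  have hind : M.Indep ((insert z B \ coloops M G : Finset α) : Set α) :=
    indep_of_rkN_eq_card (by rw [hrk5, hQ5])
  have hmemG : ∀ e ∈ ({a, b} ∪ {a', b'} : Finset α), e ∈ G := by
    intro e he
    rw [Finset.mem_union, Finset.mem_insert, Finset.mem_singleton, Finset.mem_insert, Finset.mem_singleton] at he
    rcases he with (rfl | rfl) | (rfl | rfl)
    · exact hQG (Finset.mem_sdiff.1 ha).1
    · exact hQG (Finset.mem_sdiff.1 hb).1
    · exact hQG (Finset.mem_sdiff.1 ha').1
    · exact hQG (Finset.mem_sdiff.1 hb').1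
  have hpair : ({a, b} : Finset α) ⊆ gr M := fun e he =>
    hGg (hmemG e (Finset.mem_union_left _ he))
  have hpair' : ({a', b'} : Finset α) ⊆ gr M := fun e he =>
    hGg (hmemG e (Finset.mem_union_right _ he))
  -- the union of the two pairs is an independent set of `≥ 3` points
  have hUsub : ({a, b} ∪ {a', b'} : Finset α) ⊆ insert z B \ coloops M G := by
    intro e he
    rw [Finset.mem_union, Finset.mem_insert, Finset.mem_singleton, Finset.mem_insert, Finset.mem_singleton] at he
    rcases he with (rfl | rfl) | (rfl | rfl)
    · exact ha
    · exact hb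
    · exact ha'
    · exact hb'
  have hUind : M.Indep (((({a, b} ∪ {a', b'}) : Finset α)) : Set α) := hind.subset (by exact_mod_cast hUsub)
  have hUrk : rkN M ({a, b} ∪ {a', b'}) = ({a, b} ∪ {a', b'} : Finset α).card := rkN_eq_card_of_indep hUind
  have hU3 : 3 ≤ ({a, b} ∪ {a', b'} : Finset α).card := by
    by_contra hlt
    have hle : ({a, b} ∪ {a', b'} : Finset α).card ≤ 2 := by omega
    have hsub : ({a, b} : Finset α) ⊆ {a, b} ∪ {a', b'} := Finset.subset_union_left
    have hsub' : ({a', b'} : Finset α) ⊆ {a, b} ∪ {a', b'} := Finset.subset_union_right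
    have hc : ({a, b} : Finset α).card = 2 := Finset.card_pair hab
    have hc' : ({a', b'} : Finset α).card = 2 := Finset.card_pair hab'
    have heq : ({a, b} : Finset α) = {a, b} ∪ {a', b'} := Finset.eq_of_subset_of_card_le hsub (by omega)
    have heq' : ({a', b'} : Finset α) = {a, b} ∪ {a', b'} := Finset.eq_of_subset_of_card_le hsub' (by omega)
    exact hne (heq.trans heq'.symm)
  -- `y` lies on both lines
  have hy1 : y ∈ clF M {a, b} := mem_clF_pair_of_rkN_le_two hG hs (hmemG a (by simp)) (hmemG b (by simp)) hyG hab.symm h1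
  have hy2 : y ∈ clF M {a', b'} :=
    mem_clF_pair_of_rkN_le_two hG hs (hmemG a' (by simp)) (hmemG b' (by simp)) hyG hab'.symm h2
  have hmod := rkN_inter_clF_add_le (M := M) hpair hpair'
  rw [hs a (hpair (by simp)) b (hpair (by simp)) hab, hs a' (hpair' (by simp)) b' (hpair' (by simp)) hab',
    hUrk] at hmod
  -- the intersection of the two closures has rank `≤ 4 − |{a,b} ∪ {a',b'}| ≤ 1`, but contains `y` and, when the
  -- pairs share a point `c`, also `c`
  rcases Nat.lt_or_ge ({a, b} ∪ {a', b'} : Finset α).card 4 with h3 | h4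
  · -- `|∪| = 3`: the pairs share one point `c`
    have hcard : ({a, b} ∪ {a', b'} : Finset α).card = 3 := by omega
    have hinter := Finset.card_union_add_card_inter ({a, b} : Finset α) {a', b'}
    rw [hcard, Finset.card_pair hab, Finset.card_pair hab'] at hinter
    have h1' : (({a, b} : Finset α) ∩ {a', b'}).card = 1 := by omega
    obtain ⟨c, hc⟩ := Finset.card_eq_one.1 h1'
    have hcmem : c ∈ ({a, b} : Finset α) ∩ {a', b'} := by
      rw [hc]
      exact Finset.mem_singleton_self _
    rw [Finset.mem_inter] at hcmem
    have hcy : c ≠ y := by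
      intro h
      apply hyQ
      have : c ∈ insert z B \ coloops M G := hUsub (Finset.mem_union_left _ hcmem.1)
      rw [← h]
      exact (Finset.mem_sdiff.1 this).1
    have hsub : ({c, y} : Finset α) ⊆ clF M {a, b} ∩ clF M {a', b'} := by
      intro e he
      rw [Finset.mem_insert, Finset.mem_singleton] at he
      rw [Finset.mem_inter]
      rcases he with rfl | rfl
      · exact ⟨subset_clF_of_subset_gr hpair hcmem.1, subset_clF_of_subset_gr hpair' hcmem.2⟩
      · exact ⟨hy1, hy2⟩
    have hrk := rkN_mono (M := M) hsub
    rw [hs c (hGg (hmemG c (Finset.mem_union_left _ hcmem.1))) y (hGg hyG) hcy] at hrk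
    omega
  · -- `|∪| = 4`: the intersection has rank `0`, but `y` is not a loop
    have hsub : ({y} : Finset α) ⊆ clF M {a, b} ∩ clF M {a', b'} := by
      intro e he
      rw [Finset.mem_singleton] at he
      rw [he, Finset.mem_inter]
      exact ⟨hy1, hy2⟩
    have hrk := rkN_mono (M := M) hsub
    have h1y : rkN M {y} = 1 := rkN_eq_card_of_indep (by simpa using hl y (hGg hyG))
    omega


open scoped Classical in
/-- **The loaded targets through `x` and a point `y₁` of the basis line `ℓ_ab` at level `j` number at most
`C(t₁ − 1, j − 2)`**, `t₁` the number of points of `W ∖ {x}` on `ℓ_ab`, when the off-points are generic: every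
such load is at distance one with its `Y ⊆ ℓ_ab`. -/
theorem card_loaded_targets_through_le (hG : G ∈ flatsQ M (5 + 1)) (hd : (gr M \ G).card = 2)
    (hk : kColoops M G = 1) (hs : ∀ e ∈ gr M, ∀ f ∈ gr M, e ≠ f → rkN M {e, f} = 2)
    (hl : ∀ e ∈ gr M, M.Indep {e}) (hfat : (fatClosures M 5 G 2).card ≤ 1) {B₀ : Finset α}
    (hB₀ : B₀ ∈ thinMembers M 5 G) {w₀ x : α} (hD : G \ clF M B₀ = {w₀, x})
    (hgen : ∀ R ⊆ G \ coloops M G, rkN M R = 2 → 3 ≤ R.card → 4 ≤ rkN M (insert w₀ (insert x R)))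
    {B : Finset α} (hB : B ∈ thinMembers M 5 G) (hnP : ¬ bigP M G B) {z : α} (hz : z ∈ G \ clF M B)
    (hx : x ∉ insert z B) {y₁ : α} (hy₁ : y₁ ∈ (G \ insert z B).erase x) {a b : α}
    (ha : a ∈ (insert z B \ coloops M G).erase w₀) (hb : b ∈ (insert z B \ coloops M G).erase w₀) (hab : a ≠ b)
    (hline : rkN M {a, b, y₁} ≤ 2) (j : ℕ) :
    ((tgtSets M 5 G B z).filter (fun T => ({x, y₁} : Finset α) ⊆ T ∧ (T \ insert z B).card = j ∧
      dload M 5 G (bigP M G) (dshGT2 M 5 G) T ≠ 0)).card ≤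
      ((((G \ insert z B).erase x).filter (fun y => rkN M (insert y {a, b}) ≤ 2)).erase y₁).card.choose (j - 2) := by
  have hy₁x : y₁ ≠ x := (Finset.mem_erase.1 hy₁).1
  have hy₁G : y₁ ∈ G \ insert z B := Finset.mem_of_mem_erase hy₁
  set L := ((G \ insert z B).erase x).filter (fun y => rkN M (insert y {a, b}) ≤ 2) with hL
  rw [← Finset.card_powersetCard]
  apply Finset.card_le_card_of_injOn (fun T => (T \ insert z B) \ {x, y₁})
  · intro T hT
    rw [Finset.mem_coe, Finset.mem_filter] at hT
    obtain ⟨hTt, hXT, hTj, hload⟩ := hT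
    have hTG : T ⊆ G := subset_G_of_mem_shadowAt (mem_tgtSets.1 hTt).1
    have hxT : x ∈ T := hXT (Finset.mem_insert_self _ _)
    have hy₁T : y₁ ∈ T := hXT (Finset.mem_insert_of_mem (Finset.mem_singleton_self _))
    -- the load is at distance one and its `Y` lies on a basis line through `y₁`, which is `ℓ_ab`
    obtain ⟨R, hR, hR2, hR3, hcase⟩ := loaded_fat_target_dichotomy hG hd hk hs hl hfat hB₀ hD hTG hload
    rcases hcase with ⟨hRc, -⟩ | ⟨-, hcop⟩
    · obtain ⟨a', ha', b', hb', hab', hrk⟩ :=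
        exists_basis_line_of_dist_one_fat hG hd hk hs hB hnP hz hTt hxT hx hR hR2 hRc
      have hy₁Y : y₁ ∈ (T \ insert z B).erase x :=
        Finset.mem_erase.2 ⟨hy₁x, Finset.mem_sdiff.2 ⟨hy₁T, (Finset.mem_sdiff.1 hy₁G).2⟩⟩
      have hsub₁ : ({a', b', y₁} : Finset α) ⊆ insert a' (insert b' ((T \ insert z B).erase x)) := by
        intro e he
        rw [Finset.mem_insert, Finset.mem_insert, Finset.mem_singleton] at he
        rw [Finset.mem_insert, Finset.mem_insert]
        rcases he with rfl | rfl | rfl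
        · exact Or.inl rfl
        · exact Or.inr (Or.inl rfl)
        · exact Or.inr (Or.inr hy₁Y)
      have hrk₁ : rkN M {a', b', y₁} ≤ 2 := by
        have := rkN_mono (M := M) hsub₁
        rw [hrk] at this
        exact this
      have hsame : ({a, b} : Finset α) = {a', b'} := by
        by_contra hne
        exact not_on_two_basis_lines hG hd hk hs hl hB hnP hz (Finset.mem_of_mem_erase ha)
          (Finset.mem_of_mem_erase hb) (Finset.mem_of_mem_erase ha') (Finset.mem_of_mem_erase hb') hab hab' hne
          hy₁G hline hrk₁
      rw [Finset.mem_coe, Finset.mem_powersetCard]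
      constructor
      · intro e he
        rw [Finset.mem_sdiff, Finset.mem_insert, Finset.mem_singleton, not_or] at he
        obtain ⟨heTQ, hex, hey₁⟩ := he
        refine Finset.mem_erase.2 ⟨hey₁, ?_⟩
        rw [hL, Finset.mem_filter]
        refine ⟨Finset.mem_erase.2 ⟨hex, Finset.sdiff_subset_sdiff hTG (Finset.Subset.refl _) heTQ⟩, ?_⟩
        have hsub₂ : insert e {a, b} ⊆ insert a' (insert b' ((T \ insert z B).erase x)) := by
          intro u hu
          rw [Finset.mem_insert] at hu
          rcases hu with rfl | hu
          · exact Finset.mem_insert_of_mem (Finset.mem_insert_of_mem (Finset.mem_erase.2 ⟨hex, heTQ⟩))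
          · rw [hsame, Finset.mem_insert, Finset.mem_singleton] at hu
            rw [Finset.mem_insert, Finset.mem_insert]
            rcases hu with rfl | rfl
            · exact Or.inl rfl
            · exact Or.inr (Or.inl rfl)
        have := rkN_mono (M := M) hsub₂
        rw [hrk] at this
        exact this
      · have hXsub : ({x, y₁} : Finset α) ⊆ T \ insert z B := by
          intro e he
          rw [Finset.mem_insert, Finset.mem_singleton] at he
          rcases he with rfl | rfl
          · exact Finset.mem_sdiff.2 ⟨hxT, hx⟩
          · exact Finset.mem_sdiff.2 ⟨hy₁T, (Finset.mem_sdiff.1 hy₁G).2⟩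
        rw [Finset.card_sdiff_of_subset hXsub, hTj, Finset.card_pair hy₁x.symm]
    · exfalso
      have hRV : R ⊆ G \ coloops M G := fun r hr =>
        Finset.sdiff_subset_sdiff hTG (Finset.Subset.refl _) (Finset.mem_sdiff.1 (hR hr)).1
      have := hgen R hRV hR2 hR3
      omega
  · intro T₁ hT₁ T₂ hT₂ heq
    rw [Finset.mem_coe, Finset.mem_filter] at hT₁ hT₂
    have key : ∀ T ∈ tgtSets M 5 G B z, ({x, y₁} : Finset α) ⊆ T →
        T = insert z B ∪ ({x, y₁} ∪ ((T \ insert z B) \ {x, y₁})) := by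
      intro T hT hXT
      have hQT : insert z B ⊆ T := (mem_tgtSets.1 hT).2.1
      ext e
      simp only [Finset.mem_union, Finset.mem_sdiff]
      constructor
      · intro heT
        by_cases heQ : e ∈ insert z B
        · exact Or.inl heQ
        · by_cases heX : e ∈ ({x, y₁} : Finset α)
          · exact Or.inr (Or.inl heX)
          · exact Or.inr (Or.inr ⟨⟨heT, heQ⟩, heX⟩)
      · rintro (heQ | heX | ⟨⟨heT, -⟩, -⟩)
        · exact hQT heQ
        · exact hXT heX
        · exact heT
    rw [key T₁ hT₁.1 hT₁.2.1, key T₂ hT₂.1 hT₂.2.1]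
    simp only at heq
    rw [heq]

end PercRepro.Shadow
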